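import Summits.BirchSwinnertonDyer.BirchSwinnertonDyer.Theorems.ClassRecordThreeCornerAtThreeShimuraSplitAuxLevelOfSupply
import Summits.BirchSwinnertonDyer.BirchSwinnertonDyer.Theorems.ClassRecordThreeCornerAtThreeShimuraSplitAuxNormE0Prime
import Literature.NumberTheory.EllipticCurves.TamagawaNeZeroProofs
import Summits.BirchSwinnertonDyer.BirchSwinnertonDyer.Theorems.ClassRecordThreeEulerHalvesAtThreeCarrierLocalE0AtThree
import HarnessLib

/-!
# r18 of `Cruxes/CornerAtThreeW/Lines/inert.lean` — the corner's SAVED display D from (a) the split-norm primitives, (b) the carrier-local E₀ inputs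
# (tam3-p1 g18's `stub_carrierLocalE0AtThree` text VERBATIM) and (c′) ONE prime-conductor Chebotarev–Kummer SUPPLY on the corner frames
# (cell `bsd-stepL`, seat `bsd-stepL-corner3-p2` g14 = lane B, LINE OWNER of crux 21420 `CornerAtThreeW`; `--supports stmt-BirchSwinnertonDyer-21420 --as helper`)

WHY. r17 (`…ShimuraSplitAuxNormOfStubs`, p644690) keyed the residual stub on (a) ∧ (b) ∧ (c) with (c) = `AuxiliarySplitLevel W K ι 3 q N` on the corner
frames. Lane B g14 then PROVED the group-theoretic half of (c) (`…RingClassGalSplitCyclic` p646525: `G_{ℓ₀}` cyclic of order `ℓ₀ − 1` at a split `ℓ₀`;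
`…ShimuraSplitAuxLevelOfSupply`: the split stabiliser law and `auxiliarySplitLevel_of_primeSupply`), so that (c) follows from the SMALLER text
(c′) = «for every exponent `E` and guarded level `m₀`: an odd prime `ℓ₀ ∤ N m₀` split in `K`, principal over `K[m₀]`, with `3 ∤ a_{ℓ₀} − 2` and
`3^E ∣ orderOf [𝔭_v]_{ℓ₀}` at the primes `v ∣ q` of `K`» on the corner frames (`K` imaginary quadratic, `d_K < −4`, `3` inert, `ClassX11b W 3 ∧ ¬ Surj W 3`,
`q ∣ N` split in `K` with `3 ∣ c_q`) — ONE Chebotarev–Kummer class in `K[m₀](E[3], μ_{3^E}, 𝔮^{1/3^E})/ℚ` (memo CORNER3-G14 §2: `Frob_{ℓ₀} = −I` on `E[3]`,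
`−I ∈ [G,G]` for every corner image, trivial on `K[m₀](μ_{3^E})`, of order `3^E` on the Kummer fibre at `𝔮`). THIS FILE re-keys p644690's two theorems on (c′):
`cornerE0PrimeSupplier_of_carrierLocalE0_of_splitPrimeSupplyAtThree` ((b) ∧ (c′) ⟹ the corner E′-supplier) and
`cornerAtThreeShimuraInertSavedDisplayD_of_residualStubsR18_of_casselsTate` ((a) ∧ (b) ∧ (c′) + `hCT` ⟹ `CornerAtThreeShimuraInertSavedDisplayD`, the
`hIs` binder of lane B g12's anchor consumer). So the (U)-side of 21420's line factors through PRINT-level primitives (a), two LOCAL Tate-curve facts (b)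
and ONE CHEBOTAREV–KUMMER existence statement (c′) — no identity-component label, no class-field-theoretic stub left.
HONEST FRAMING: THEOREMS ONLY (no definition, no named fact, no `sorry`); (a), (b), (c′), `hCT` are HYPOTHESES; nothing closes; 21420 OPEN; no census
label moves (T7); BSD is proved for no curve. References (locators only): [cite: Darmon2004, Prop. 3.10, Def. 3.12, Thm. 4.18] [cite: GrossLMS1991, §6 p. 245]
[cite: SilvermanATAEC1994, IV Cor. 9.2 (d), C.15] [cite: Cox2013, §7.D Thm. 7.24, Thm. 8.12, §9.A] [cite: Serre1972, §2.6 Prop. 15]. presearch: n∕a (re-keying).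
Axioms: `propext`, `Classical.choice`, `Quot.sound`.
-/

set_option autoImplicit false
set_option linter.dupNamespace false

noncomputable section

open scoped Classical NumberField Pointwise

namespace Summit.BirchSwinnertonDyer.BirchSwinnertonDyer.Theorems.ShimuraWalk

open WeierstrassCurve IsDedekindDomain NumberField Field Function Literature.NumberTheory.EllipticCurves
  Literature.NumberTheory.EllipticCurves.ModularForms Literature.NumberTheory.EllipticCurves.Rank1Residual
  Literature.NumberTheory.GaloisRepresentations Literature.NumberTheory.Automorphic
  Literature.NumberTheory.NumberFields Literature.NumberTheory.NumberFields.RingClassField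
  Summit.BirchSwinnertonDyer.Rank1Residual Summit.BirchSwinnertonDyer.Rank1Residual.X11b
  Summit.BirchSwinnertonDyer.Rank1Residual.X11b.Three
  Literature.NumberTheory.EllipticCurves.ShimuraCMFamily
/-- **The corner E′-SUPPLIER from the r18 stub texts (b) ∧ (c′)** — (b) = tam3-p1 g18's `stub_carrierLocalE0AtThree` VERBATIM ((T) ∧ (C) at every `q` with
`3 ∣ c_q` split in `K`), (c′) = the split prime-conductor Chebotarev–Kummer supply on the corner frames (⟹ `AuxiliarySplitLevel W K ι 3 q N` by lane B g14's
`auxiliarySplitLevel_of_primeSupply`); output = the binder `hE0sup` of `cornerAtThreeShimuraInertSavedDisplayD_of_primitivesWithSplitNormTD_of_E0PrimeSupplier_of_casselsTate`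
(p643495 §3), through its §1 `labelE0Prime_at_carrier_of_galTrivial_of_kills_of_splitAuxLevel`. CONDITIONAL; nothing booked. [cite: Darmon2004, Prop. 3.10]
[cite: GrossLMS1991, §6 p. 245] [cite: SilvermanATAEC1994, IV Cor. 9.2 (d), C.15] [cite: Cox2013, §7.D Thm. 7.24, Thm. 8.12] -/
theorem cornerE0PrimeSupplier_of_carrierLocalE0_of_splitPrimeSupplyAtThree
    (hTC : ∀ (W : WeierstrassCurve ℚ) [W.IsElliptic] [W.IsGloballyMinimal] (K : Type) [Field K] [NumberField K] (ι : K →+* ℂ)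
      [∀ j : ℕ, NumberField (ringClassField K ι j)],
      IsImaginaryQuadratic K → ∀ (q : ℕ) [Fact q.Prime], 3 ∣ (W.baseChange ℚ_[q]).localTamagawaNumber ℤ_[q] →
      ((Ideal.span {(q : ℤ)}).primesOver (𝓞 K)).ncard = 2 →
      (∀ n : ℕ, n ≠ 0 → ¬ q ∣ n → ∀ (w : HeightOneSpectrum (𝓞 (ringClassField K ι n))),
        ((q : ℕ) : 𝓞 (ringClassField K ι n)) ∈ w.asIdeal →
        ∀ τ : ringClassField K ι n ≃ₐ[ℚ] ringClassField K ι n, τ • w.asIdeal = w.asIdeal →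
        ∀ P : (W.baseChange (ringClassField K ι n)).toAffine.Point,
          (placeIntModel W (ringClassField K ι n) w).HasNonsingularReduction (K := ringClassField K ι n)
            (pointGalHom W (ringClassField K ι n) τ P - P)) ∧
      (∀ n : ℕ, n ≠ 0 → ¬ q ∣ n → ∀ (w : HeightOneSpectrum (𝓞 (ringClassField K ι n))),
        ((q : ℕ) : 𝓞 (ringClassField K ι n)) ∈ w.asIdeal →
        ∀ P : (W.baseChange (ringClassField K ι n)).toAffine.Point,
          (placeIntModel W (ringClassField K ι n) w).HasNonsingularReduction (K := ringClassField K ι n)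
            ((W.baseChange ℚ_[q]).localTamagawaNumber ℤ_[q] • P)))
    (hSup : ∀ (W : WeierstrassCurve ℚ) [W.IsElliptic] [W.IsGloballyMinimal] (K : Type) [Field K] [NumberField K] (ι : K →+* ℂ)
      [∀ j : ℕ, NumberField (ringClassField K ι j)],
      IsImaginaryQuadratic K → NumberField.discr K < -4 →
      ((Ideal.span {(3 : ℤ)}).primesOver (𝓞 K)).ncard = 1 → ¬ (3 : ℤ) ∣ NumberField.discr K →
      ClassX11b W 3 → ¬ Surj W 3 →
      ∀ (q N : ℕ) [Fact q.Prime], ((Ideal.span {(q : ℤ)}).primesOver (𝓞 K)).ncard = 2 → N ≠ 0 → q ∣ N →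
      3 ∣ (W.baseChange ℚ_[q]).localTamagawaNumber ℤ_[q] →
      ∀ E m₀ : ℕ, Squarefree m₀ → (∀ r ∈ m₀.primeFactors, ¬ r ∣ N ∧ (Ideal.span {(r : 𝓞 K)}).IsPrime) →
        ∃ ℓ₀ : ℕ, ℓ₀.Prime ∧ ℓ₀ ≠ 2 ∧ ¬ ℓ₀ ∣ N ∧ ¬ ℓ₀ ∣ m₀ ∧ ((Ideal.span {(ℓ₀ : ℤ)}).primesOver (𝓞 K)).ncard = 2 ∧
          (∀ v : HeightOneSpectrum (𝓞 K), ((ℓ₀ : ℕ) : 𝓞 K) ∈ v.asIdeal → primeClass m₀ v = 1) ∧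
          ¬ (3 : ℤ) ∣ W.frobeniusTrace ℓ₀ - 2 ∧
          ∀ v : HeightOneSpectrum (𝓞 K), ((q : ℕ) : 𝓞 K) ∈ v.asIdeal → 3 ^ E ∣ orderOf (primeClass ℓ₀ v)) :
    ∀ (W : WeierstrassCurve ℚ) [W.IsElliptic] [W.IsGloballyMinimal] (N : ℕ) [NeZero N] (K : Type) [Field K] [NumberField K]
      (S : Finset ℕ), ClassX11b W 3 → ¬ Surj W 3 → W.conductorNorm ℤ = N →
      ∀ (hK : IsImaginaryQuadratic K), NumberField.discr K < -4 →
      (∀ ℓ ∈ S, ℓ.Prime ∧ ℓ ∣ N ∧ ¬ ℓ ^ 2 ∣ N ∧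
        ((Ideal.span {(ℓ : ℤ)}).primesOver (𝓞 K)).ncard = 1 ∧ ¬ (ℓ : ℤ) ∣ NumberField.discr K) →
      (∀ ℓ : ℕ, ℓ.Prime → ℓ ∣ N → ℓ ∉ S → ((Ideal.span {(ℓ : ℤ)}).primesOver (𝓞 K)).ncard = 2) →
      3 ∈ S →
      ∀ (ι : K →+* ℂ) (y : (W.baseChange K).toAffine.Point)
        (ys : (m : ℕ) → (W.baseChange (ringClassField K ι m)).toAffine.Point) (ε : ℤ),
        LabelsAt W N K ι y ys ε → SplitNormAt W N K ι ys →
        ∀ (q : ℕ) [Fact q.Prime], q ∣ N → q ∉ S → 3 ∣ (W.baseChange ℚ_[q]).localTamagawaNumber ℤ_[q] →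
          ∃ n' : ℕ, ¬ 3 ∣ n' ∧ ∀ m : ℕ, Squarefree m →
            (∀ r ∈ m.primeFactors, ¬ r ∣ N ∧ (Ideal.span {(r : 𝓞 K)}).IsPrime) →
            ∀ [NumberField (ringClassField K ι m)] (w : HeightOneSpectrum (𝓞 (ringClassField K ι m))),
              ((q : ℕ) : 𝓞 (ringClassField K ι m)) ∈ w.asIdeal →
              (placeIntModel W (ringClassField K ι m) w).HasNonsingularReduction (K := ringClassField K ι m) (n' • ys m) := by
  intro W _ _ N _ K _ _ S hX hns _hN hK hD hin hsp h3S ι y ys ε _hL hSN q _ hqN hqS h3q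
  haveI : ∀ j : ℕ, NumberField (ringClassField K ι j) := Summit.BirchSwinnertonDyer.Rank1Residual.JET.numberField_ringClassField K hK ι
  haveI : (W.baseChange ℚ_[q]).IsElliptic := inferInstanceAs (W.map (algebraMap ℚ ℚ_[q])).IsElliptic
  have hq2 := hsp q (Fact.out : q.Prime) hqN hqS
  have hc0 : (W.baseChange ℚ_[q]).localTamagawaNumber ℤ_[q] ≠ 0 :=
    localTamagawaNumber_padic_ne_zero_holds q (W.baseChange ℚ_[q])
  obtain ⟨hT, hC⟩ := hTC W K ι hK q h3q hq2
  exact labelE0Prime_at_carrier_of_galTrivial_of_kills_of_splitAuxLevel W ι hK hqN hc0 hT hC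
    (auxiliarySplitLevel_of_primeSupply W hK hD ι hqN
      (hSup W K ι hK hD (hin 3 h3S).2.2.2.1 (hin 3 h3S).2.2.2.2 hX hns q N hq2 (NeZero.ne N) hqN h3q)) ys hSN

/-- **`CornerAtThreeShimuraInertSavedDisplayD` from the Cassels–Tate level inputs and the r18 stub text `(a) ∧ (b) ∧ (c′)`** — (a) the split-norm primitives
`ShimuraWalk.PrimitivesWithSplitNormTDAtThree` (print-level by statement), (b) tam3-p1 g18's `stub_carrierLocalE0AtThree` text (shared with 19109 r17),
(c′) the split prime-conductor Chebotarev–Kummer supply on the corner frames: §3 of p643495 on the supplier above. This IS the `hIs` binder of lane B g12's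
anchor consumer `cornerAtThreeUpperConsumed_of_displays_of_residualAnchor_of_twinLowerD`. NO identity-component ∕ E′ label and NO class-field-theoretic input
among the hypotheses. CONDITIONAL; nothing closes; BSD is proved for no curve.
[cite: Darmon2004, Prop. 3.10, Thm. 4.18] [cite: Jetchev2008, Thm. 1.1, Thm. 1.4] [cite: SilvermanATAEC1994, IV Cor. 9.2 (d)] [cite: MilneADT2006, Ch. I Thm. 4.10, §6]
[cite: Cox2013, Thm. 8.12] -/
theorem cornerAtThreeShimuraInertSavedDisplayD_of_residualStubsR18_of_casselsTate
    (hCT : ∀ (K : Type) [Field K] [NumberField K], Literature.NumberTheory.EllipticCurves.casselsTate_levelInputs K)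
    (hres :
      PrimitivesWithSplitNormTDAtThree ∧
      (∀ (W : WeierstrassCurve ℚ) [W.IsElliptic] [W.IsGloballyMinimal] (K : Type) [Field K] [NumberField K] (ι : K →+* ℂ)
        [∀ j : ℕ, NumberField (ringClassField K ι j)],
        IsImaginaryQuadratic K → ∀ (q : ℕ) [Fact q.Prime], 3 ∣ (W.baseChange ℚ_[q]).localTamagawaNumber ℤ_[q] →
        ((Ideal.span {(q : ℤ)}).primesOver (𝓞 K)).ncard = 2 →
        (∀ n : ℕ, n ≠ 0 → ¬ q ∣ n → ∀ (w : HeightOneSpectrum (𝓞 (ringClassField K ι n))),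
          ((q : ℕ) : 𝓞 (ringClassField K ι n)) ∈ w.asIdeal →
          ∀ τ : ringClassField K ι n ≃ₐ[ℚ] ringClassField K ι n, τ • w.asIdeal = w.asIdeal →
          ∀ P : (W.baseChange (ringClassField K ι n)).toAffine.Point,
            (placeIntModel W (ringClassField K ι n) w).HasNonsingularReduction (K := ringClassField K ι n)
              (pointGalHom W (ringClassField K ι n) τ P - P)) ∧
        (∀ n : ℕ, n ≠ 0 → ¬ q ∣ n → ∀ (w : HeightOneSpectrum (𝓞 (ringClassField K ι n))),
          ((q : ℕ) : 𝓞 (ringClassField K ι n)) ∈ w.asIdeal →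
          ∀ P : (W.baseChange (ringClassField K ι n)).toAffine.Point,
            (placeIntModel W (ringClassField K ι n) w).HasNonsingularReduction (K := ringClassField K ι n)
              ((W.baseChange ℚ_[q]).localTamagawaNumber ℤ_[q] • P))) ∧
      (∀ (W : WeierstrassCurve ℚ) [W.IsElliptic] [W.IsGloballyMinimal] (K : Type) [Field K] [NumberField K] (ι : K →+* ℂ)
        [∀ j : ℕ, NumberField (ringClassField K ι j)],
        IsImaginaryQuadratic K → NumberField.discr K < -4 →
        ((Ideal.span {(3 : ℤ)}).primesOver (𝓞 K)).ncard = 1 → ¬ (3 : ℤ) ∣ NumberField.discr K →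
        ClassX11b W 3 → ¬ Surj W 3 →
        ∀ (q N : ℕ) [Fact q.Prime], ((Ideal.span {(q : ℤ)}).primesOver (𝓞 K)).ncard = 2 → N ≠ 0 → q ∣ N →
        3 ∣ (W.baseChange ℚ_[q]).localTamagawaNumber ℤ_[q] →
        ∀ E m₀ : ℕ, Squarefree m₀ → (∀ r ∈ m₀.primeFactors, ¬ r ∣ N ∧ (Ideal.span {(r : 𝓞 K)}).IsPrime) →
          ∃ ℓ₀ : ℕ, ℓ₀.Prime ∧ ℓ₀ ≠ 2 ∧ ¬ ℓ₀ ∣ N ∧ ¬ ℓ₀ ∣ m₀ ∧ ((Ideal.span {(ℓ₀ : ℤ)}).primesOver (𝓞 K)).ncard = 2 ∧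
            (∀ v : HeightOneSpectrum (𝓞 K), ((ℓ₀ : ℕ) : 𝓞 K) ∈ v.asIdeal → primeClass m₀ v = 1) ∧
            ¬ (3 : ℤ) ∣ W.frobeniusTrace ℓ₀ - 2 ∧
            ∀ v : HeightOneSpectrum (𝓞 K), ((q : ℕ) : 𝓞 K) ∈ v.asIdeal → 3 ^ E ∣ orderOf (primeClass ℓ₀ v))) :
    CornerAtThreeShimuraInertSavedDisplayD :=
  cornerAtThreeShimuraInertSavedDisplayD_of_primitivesWithSplitNormTD_of_E0PrimeSupplier_of_casselsTate hCT hres.1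
    (cornerE0PrimeSupplier_of_carrierLocalE0_of_splitPrimeSupplyAtThree hres.2.1 hres.2.2)
/-! ## r19 — (b) DISCHARGED by tam3-p1 g18's `CarrierLocalE0.stub_carrierLocalE0AtThree` (p645044 ✓): the residual = (a) ∧ (c′) -/

/-- **`CornerAtThreeShimuraInertSavedDisplayD` from the Cassels–Tate level inputs and the r19 stub text `(a) ∧ (c′)`** — (b), the carrier-local E₀ inputs
(T) ∧ (C), is now a TREE THEOREM with the verbatim text (tam3-p1 g18, `Summit.BirchSwinnertonDyer.BirchSwinnertonDyer.Theorems.CarrierLocalE0.stub_carrierLocalE0AtThree`,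
Kodaira–Néron over the unramified completion), so the r18 consumer needs only (a) the split-norm primitives `PrimitivesWithSplitNormTDAtThree` (print-level by statement)
and (c′) the split prime-conductor Chebotarev–Kummer supply on the corner frames. This IS the `hIs` binder of lane B g12's anchor consumer. CONDITIONAL on (a), (c′), `hCT`;
nothing closes; BSD is proved for no curve. [cite: Darmon2004, Prop. 3.10, Thm. 4.18] [cite: SilvermanATAEC1994, IV Cor. 9.2 (d)] [cite: Cox2013, Thm. 8.12] -/
theorem cornerAtThreeShimuraInertSavedDisplayD_of_residualStubsR19_of_casselsTate
    (hCT : ∀ (K : Type) [Field K] [NumberField K], Literature.NumberTheory.EllipticCurves.casselsTate_levelInputs K)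
    (hres :
      PrimitivesWithSplitNormTDAtThree ∧
      (∀ (W : WeierstrassCurve ℚ) [W.IsElliptic] [W.IsGloballyMinimal] (K : Type) [Field K] [NumberField K] (ι : K →+* ℂ)
        [∀ j : ℕ, NumberField (ringClassField K ι j)],
        IsImaginaryQuadratic K → NumberField.discr K < -4 →
        ((Ideal.span {(3 : ℤ)}).primesOver (𝓞 K)).ncard = 1 → ¬ (3 : ℤ) ∣ NumberField.discr K →
        ClassX11b W 3 → ¬ Surj W 3 →
        ∀ (q N : ℕ) [Fact q.Prime], ((Ideal.span {(q : ℤ)}).primesOver (𝓞 K)).ncard = 2 → N ≠ 0 → q ∣ N →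
        3 ∣ (W.baseChange ℚ_[q]).localTamagawaNumber ℤ_[q] →
        ∀ E m₀ : ℕ, Squarefree m₀ → (∀ r ∈ m₀.primeFactors, ¬ r ∣ N ∧ (Ideal.span {(r : 𝓞 K)}).IsPrime) →
          ∃ ℓ₀ : ℕ, ℓ₀.Prime ∧ ℓ₀ ≠ 2 ∧ ¬ ℓ₀ ∣ N ∧ ¬ ℓ₀ ∣ m₀ ∧ ((Ideal.span {(ℓ₀ : ℤ)}).primesOver (𝓞 K)).ncard = 2 ∧
            (∀ v : HeightOneSpectrum (𝓞 K), ((ℓ₀ : ℕ) : 𝓞 K) ∈ v.asIdeal → primeClass m₀ v = 1) ∧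
            ¬ (3 : ℤ) ∣ W.frobeniusTrace ℓ₀ - 2 ∧
            ∀ v : HeightOneSpectrum (𝓞 K), ((q : ℕ) : 𝓞 K) ∈ v.asIdeal → 3 ^ E ∣ orderOf (primeClass ℓ₀ v))) :
    CornerAtThreeShimuraInertSavedDisplayD :=
  cornerAtThreeShimuraInertSavedDisplayD_of_residualStubsR18_of_casselsTate hCT
    ⟨hres.1, Summit.BirchSwinnertonDyer.BirchSwinnertonDyer.Theorems.CarrierLocalE0.stub_carrierLocalE0AtThree, hres.2⟩

end Summit.BirchSwinnertonDyer.BirchSwinnertonDyer.Theorems.ShimuraWalk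

end
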